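import Literature.NumberTheory.EllipticCurves.HeegnerPointsKolyvaginPrimaryNoTorsionProofs
import Literature.NumberTheory.EllipticCurves.SerreOpenImageDeterminantProofs
import HarnessLib

/-!
# No `p`-torsion over a field of GENERALISED-DIHEDRAL type when `E[p]` is irreducible and `p ≥ 5`
# (Matar–Nekovář 2019 Prop. 6.5, (C5) ⇒ (C2); the irreducible-image twin of Gross 1991 Lemma 4.3)

Sibling proof file (theorems only, no named fact; D-0014 / D-0026) of
`HeegnerPointsKolyvaginPrimaryNoTorsionProofs`, which proves Gross 1991 Lemma 4.3 — *"The curve `E`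
has no `p`-torsion rational over `K_n`"* — under the SURJECTIVITY of `ρ̄_{E,p}`
(`torsionBy_eq_bot_of_normal_of_hasSurjectiveModNGaloisRep`). Matar–Nekovář, *Kolyvagin's result
on the vanishing of `Ш(E/K)[p^∞]` and its consequences for anticyclotomic Iwasawa theory*, JTNB 31
(2019), Prop. 6.4 lists Gross's input as *"(C2) For each `n ≥ 1` relatively prime to `pND_K`,
`E(H_n)[p] = 0`"* (p. 497) and Prop. 6.5 states *"For any prime number `p ≠ 2`, the conditions
(C2), (C3), (C4) and (C6) in Proposition 6.4 follow from (C5)"* [(C5): `ρ̄|_{G_K}` irreducible],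
*"The implication (C5) ⟹ (C2) is a special case of Proposition 5.31 (8)"* (p. 498), whose proof
(p. 496) runs: *"`Gal(L₁ ∩ H₁/ℚ)` acts on the line `T^{H₁}` by a character
`α : Gal(L₁ ∩ H₁/ℚ) → Gal(L₁ ∩ H₁/ℚ)^{ab} → k^×`. However, `Gal(L₁ ∩ H₁/ℚ)^{ab}` is a quotient of
`Gal(H₁/ℚ)^{ab} = Gal(K_gen/ℚ)` … As `χ_{p,K} ≠ 1` for `p > 3`, it follows …"* — i.e. the only
structural input about the ring class field is that the ABELIANISATION of `Gal(H_n/ℚ)` is killed by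
`2` (genus theory: `Gal(H_n/ℚ) = Pic(𝒪_n) ⋊ ⟨complex conjugation⟩` is generalised dihedral).

This file proves the corresponding kernel statement at irreducible image over `ℚ` and `p ≥ 5`,
with the class-field-theoretic structure of `K[n]/ℚ` carried — exactly as in the surjective sibling —
as explicit hypotheses on a normal subgroup `N ⊴ Γ_ℚ` contained in the image of `Γ_L`:

* `torsionBy_eq_bot_of_sq_mem_of_hasIrreducibleModPGaloisRep(_type)` — **core**: if every square
  of `Γ_ℚ` lies in `N · [Γ_ℚ, Γ_ℚ]` (the abelianisation of `Γ_ℚ/N` has exponent `2`), `E[p]` is an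
  irreducible `Γ_ℚ`-module and `p ≥ 5`, then `E(L)[p] = 0`. Proof: a non-zero `P ∈ E(L)[p]` gives a
  non-zero `Q ∈ E[p]` fixed by `N`; `E[p]^N` is `Γ_ℚ`-stable (normality) and non-zero, so equals
  `E[p]` by irreducibility; hence `ρ̄_{E,p}` is trivial on `N` and the determinant character
  `det ρ̄ = χ̄_p : Γ_ℚ → 𝔽_pˣ` (a homomorphism to an abelian group, onto by the Weil pairing — tree
  `exists_frame_galoisRepTorsion_rat`) kills `N` and all commutators, so `χ̄_p(g)² = 1` for every
  `g`; but `χ̄_p` takes the value `2`, and `2² = 4 ≠ 1` in `𝔽_p` for `p ≥ 5`.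
* `torsionBy_eq_bot_of_dihedral_of_hasIrreducibleModPGaloisRep(_type)` — the **generalised-dihedral
  reading**: `A ≤ Γ_ℚ` (printed: `Γ_K`) containing `N`, `τ ∈ Γ_ℚ` (complex conjugation) with
  `τ² ∈ N`, `Γ_ℚ = A ∪ τA`, and `τ a τ⁻¹ a ∈ N` for `a ∈ A` (conjugation inverts `Gal(K[n]/K)`) ⟹
  every square lies in `N · [Γ_ℚ, Γ_ℚ]` (`a² = [a, τ]·(τaτ⁻¹a)`, `(τa)² = (τaτ⁻¹a)·(a⁻¹τ²a)`), hence
  `E(L)[p] = 0`; and `E(L)[p^M] = 0` (`torsionBy_pow_eq_bot_…`, McCallum §4 (5)).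

No surjectivity, no ramification hypothesis (`p ∤ n d_K`) and no parity of `d_K` is used; `p ≥ 5`
is needed (at `p = 3` the determinant IS quadratic and CM curves give counterexamples). Identifying
`N = Γ_{K[n]}`, `A = Γ_K`, `τ` for the tree's `ringClassField K ι n` is class field theory (Cox,
Thm. 9.18) and is not done here, as in the surjective sibling.

## References

* [MatarNekovar2019] A. Matar, J. Nekovář, JTNB 31 (2019) 455–501: Prop. 6.4 (C2) (p. 497),
  Prop. 6.5 and its proof (p. 498), Prop. 5.31 (2)/(8) and proof of (8) (pp. 495–496).
  Held: `paper:doi-10-5802-jtnb-1091` p0044 L50, p0045 L18–24, p0043 L15–22.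
* [GrossLMS1991] B. H. Gross, *Kolyvagin's work on modular elliptic curves*, LMS LN 153 (1991),
  Lemma 4.3 (p. 242) — the surjective-image statement and the "group of dihedral type" argument.
* [McCallumLMS1991] W. G. McCallum, same volume, §4 (5) (`E(K_n)[p^M] = 0` from `E(K_n)[p] = 0`).
* [Serre1972] J.-P. Serre, Invent. Math. 15 (1972), §5.2 (iii) (`det ρ̄_{E,p} = χ̄_p` onto `𝔽_pˣ`).
-/

noncomputable section

open scoped Classical

universe u

namespace Literature.NumberTheory.EllipticCurves

open Field (absoluteGaloisGroup)
open Field.absoluteGaloisGroup (toAlgEquiv)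

/-! ## Group theory: generalised dihedral ⟹ every square lies in `N · [Γ, Γ]` -/

section GroupTheory

variable {Γ : Type*} [Group Γ]

/-- **Squares in a group of generalised-dihedral type.** Let `N ⊴ Γ`, `A ≤ Γ` with `N ≤ A`, and
`τ ∈ Γ` with `τ² ∈ N`, `Γ = A ∪ τA` and `τ a τ⁻¹ a ∈ N` for all `a ∈ A` (printed: `Γ/N = Gal(K[n]/ℚ)
= Gal(K[n]/K) ⋊ ⟨τ⟩`, complex conjugation `τ` acting on the abelian group `Gal(K[n]/K)` by
inversion). Then every square `g²` lies in `N ⊔ [Γ, Γ]`: `a² = [a, τ] · (τ a τ⁻¹ a)` and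
`(τ a)² = (τ a τ⁻¹ a) · (a⁻¹ τ² a)`. [cite: MatarNekovar2019, proof of Prop. 5.31 (8) (p. 496)]
[cite: GrossLMS1991, Lemma 4.3 (p. 242)] -/
theorem mul_self_mem_sup_commutator_of_dihedral (N : Subgroup Γ) [hN : N.Normal] (A : Subgroup Γ)
    (τ : Γ) (hτ : τ * τ ∈ N) (hcov : ∀ g : Γ, g ∈ A ∨ τ⁻¹ * g ∈ A)
    (hinv : ∀ a ∈ A, τ * a * τ⁻¹ * a ∈ N) (g : Γ) : g * g ∈ N ⊔ commutator Γ := by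
  rcases hcov g with hg | hg
  · -- `g ∈ A`: `g² = [g, τ] · (τ g τ⁻¹ g)`
    have hc : g * τ * g⁻¹ * τ⁻¹ ∈ commutator Γ :=
      Subgroup.commutator_mem_commutator (Subgroup.mem_top g) (Subgroup.mem_top τ)
    have heq : g * g = (g * τ * g⁻¹ * τ⁻¹) * (τ * g * τ⁻¹ * g) := by group
    rw [heq]
    exact Subgroup.mul_mem _ (Subgroup.mem_sup_right hc) (Subgroup.mem_sup_left (hinv g hg))
  · -- `g = τ a` with `a = τ⁻¹ g ∈ A`: `g² = (τ a τ⁻¹ a) · (a⁻¹ τ² a)`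
    set a := τ⁻¹ * g with ha
    have hga : g = τ * a := by rw [ha, ← mul_assoc, mul_inv_cancel, one_mul]
    have hn2 : a⁻¹ * (τ * τ) * a ∈ N := by
      have := hN.conj_mem _ hτ a⁻¹
      rwa [inv_inv] at this
    have heq : g * g = (τ * a * τ⁻¹ * a) * (a⁻¹ * (τ * τ) * a) := by rw [hga]; group
    rw [heq]
    exact Subgroup.mem_sup_left (N.mul_mem (hinv a hg) hn2)

end GroupTheory

/-! ## `E(L)[p] = 0` when `Γ_ℚ/N` has abelianisation of exponent `2`, `E[p]` irreducible, `p ≥ 5` -/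

section Torsion

variable (L : Type) [Field L] [NumberField L] (W : WeierstrassCurve ℚ) [W.IsElliptic]

/-- **Core statement (for `L` in `Type`).** Let `W/ℚ` be elliptic, `p ≥ 5` a prime with `E[p]` an
IRREDUCIBLE `Γ_ℚ`-module, and `L` a number field for which there is a normal subgroup `N ⊴ Γ_ℚ`
contained in the image of `Γ_L → Γ_ℚ` (printed: `L = H_n = K[n]` Galois over `ℚ`, `N = Γ_{H_n}`)
such that every square of `Γ_ℚ` lies in `N · [Γ_ℚ, Γ_ℚ]` (printed: `Gal(H_n/ℚ)^{ab} = Gal(K_gen/ℚ)` is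
killed by `2`). Then `E(L)[p] = 0`. Proof: `0 ≠ Q ∈ E[p]` fixed by `N` ⟹ `E[p]^N = E[p]`
(Γ-stable by normality, non-zero, irreducibility) ⟹ `det ρ̄ = χ̄_p` kills `N` and `[Γ_ℚ, Γ_ℚ]` ⟹
`χ̄_p(g)² = 1` for all `g` ⟹ (`χ̄_p` onto `𝔽_pˣ`) `2² = 1` in `𝔽_p`, i.e. `p ∣ 3`: impossible for
`p ≥ 5`. [cite: MatarNekovar2019, Prop. 6.5 ((C5) ⇒ (C2), p. 498) and proof of Prop. 5.31 (8) (p. 496)]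
[cite: GrossLMS1991, Lemma 4.3 (p. 242)] [cite: Serre1972, §5.2 (iii)] -/
theorem torsionBy_eq_bot_of_sq_mem_of_hasIrreducibleModPGaloisRep_type {p : ℕ} (hp : p.Prime)
    (hp5 : 5 ≤ p) (hirr : W.HasIrreducibleModPGaloisRep p)
    (N : Subgroup (absoluteGaloisGroup ℚ)) [N.Normal]
    (hN : ∀ n ∈ N, ∃ τ : absoluteGaloisGroup L, resGal (K := ℚ) L τ = n)
    (hsq : ∀ g : absoluteGaloisGroup ℚ, g * g ∈ N ⊔ commutator (absoluteGaloisGroup ℚ)) :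
    AddSubgroup.torsionBy (W.baseChange L).toAffine.Point (p : ℤ) = ⊥ := by
  rw [eq_bot_iff]
  intro P hP
  rw [AddSubgroup.mem_bot]
  by_contra hP0
  have hPp : p • P = 0 := AddSubgroup.torsionBy.nsmul_iff.mp hP
  -- the point over `L̄` and its preimage `Q` over `ℚ̄`
  let f : L →ₐ[ℚ] AlgebraicClosure L := (algebraMap L (AlgebraicClosure L)).toRatAlgHom
  let φ : (W.baseChange L).toAffine.Point →+ localPoints W L :=
    WeierstrassCurve.Affine.Point.map f
  have hφ : Function.Injective φ := WeierstrassCurve.Affine.Point.map_injective _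
  obtain ⟨Q, hQ⟩ := (pointsMapOfEmb_bijective L W (closureEmb (K := ℚ) L)).2 (φ P)
  have hQ' : pointsMap W L Q = φ P := hQ
  have hinj : Function.Injective (pointsMap W L) :=
    (pointsMapOfEmb_bijective L W (closureEmb (K := ℚ) L)).1
  have hQ0 : Q ≠ 0 := by
    rintro rfl
    apply hP0
    apply hφ
    rw [map_zero, ← hQ', map_zero]
  have hQp : p • Q = 0 := by
    apply hinj
    rw [map_nsmul, map_zero, hQ', ← map_nsmul, hPp, map_zero]
  -- `Q` is fixed by `Γ_L`, hence by `N`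
  have hfixL : ∀ τ : absoluteGaloisGroup L, resGal (K := ℚ) L τ • Q = Q := by
    intro τ
    apply hinj
    rw [pointsMap_smul, hQ']
    change WeierstrassCurve.Affine.Point.map
        ((AlgEquiv.restrictScalars ℚ (toAlgEquiv L τ) :
            AlgebraicClosure L ≃ₐ[ℚ] AlgebraicClosure L) :
          AlgebraicClosure L →ₐ[ℚ] AlgebraicClosure L)
        (WeierstrassCurve.Affine.Point.map f P) =
      WeierstrassCurve.Affine.Point.map f P
    have hgf : ((AlgEquiv.restrictScalars ℚ (toAlgEquiv L τ) :
            AlgebraicClosure L ≃ₐ[ℚ] AlgebraicClosure L) :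
          AlgebraicClosure L →ₐ[ℚ] AlgebraicClosure L).comp f = f := by
      ext x
      exact (toAlgEquiv L τ).commutes x
    rw [WeierstrassCurve.Affine.Point.map_map, hgf]
  have hfixN : ∀ n ∈ N, n • Q = Q := fun n hn ↦ by
    obtain ⟨τ, rfl⟩ := hN n hn
    exact hfixL τ
  -- `E[p]^N` is a non-zero `Γ_ℚ`-stable subgroup of `E[p]`, hence all of `E[p]`
  haveI : Fact p.Prime := ⟨hp⟩
  let Mp := ↥(WeierstrassCurve.geomTorsion W (p : ℤ))
  let Qm : Mp := ⟨Q, AddSubgroup.torsionBy.nsmul_iff.mpr hQp⟩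
  have hQm0 : Qm ≠ 0 := fun h ↦ hQ0 (congrArg Subtype.val h)
  have hQmN : ∀ n ∈ N, n • Qm = Qm := fun n hn ↦ Subtype.ext (hfixN n hn)
  let H : AddSubgroup Mp :=
    { carrier := {R | ∀ n ∈ N, n • R = R}
      zero_mem' := fun n _ ↦ smul_zero n
      add_mem' := fun {u v} hu hv n hn ↦ by rw [smul_add, hu n hn, hv n hn]
      neg_mem' := fun {u} hu n hn ↦ by rw [smul_neg, hu n hn] }
  have hHstab : ∀ σ : absoluteGaloisGroup ℚ, ∀ R ∈ H, σ • R ∈ H :=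
    fun σ R hR n hn ↦ smul_smul_eq_of_normal hR σ hn
  have hHtop : H = ⊤ := by
    refine (hirr H hHstab).resolve_left fun hbot ↦ hQm0 ?_
    have hmem : Qm ∈ H := hQmN
    rw [hbot] at hmem
    exact (AddSubgroup.mem_bot).mp hmem
  have hfixAll : ∀ n ∈ N, ∀ R : Mp, n • R = R := fun n hn R ↦
    (show R ∈ H from hHtop ▸ AddSubgroup.mem_top R) n hn
  -- so `ρ̄_{E,p}` is trivial on `N`
  have hρN : ∀ n ∈ N, WeierstrassCurve.galoisRepTorsion W (p : ℤ) n = 1 := fun n hn ↦ by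
    rw [← map_one (WeierstrassCurve.galoisRepTorsion W (p : ℤ))]
    apply Multiplicative.toAdd.injective
    ext R
    rw [WeierstrassCurve.galoisRepTorsion_apply, WeierstrassCurve.galoisRepTorsion_apply, one_smul]
    exact congrArg Subtype.val (hfixAll n hn R)
  -- the determinant character in a frame: a hom to the abelian group `𝔽_pˣ`, onto
  obtain ⟨e, Φ, -, -, -, hdetsurj, -⟩ := WeierstrassCurve.exists_frame_galoisRepTorsion_rat W p
  let d : absoluteGaloisGroup ℚ →* (ZMod p)ˣ :=
    (Matrix.GeneralLinearGroup.det).comp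
      (Φ.toMonoidHom.comp (WeierstrassCurve.galoisRepTorsion W (p : ℤ)))
  have hd_apply : ∀ g : absoluteGaloisGroup ℚ,
      d g = Matrix.GeneralLinearGroup.det (Φ (WeierstrassCurve.galoisRepTorsion W (p : ℤ) g)) :=
    fun g ↦ rfl
  have hdN : N ≤ d.ker := fun n hn ↦ by
    rw [MonoidHom.mem_ker, hd_apply, hρN n hn, map_one, map_one]
  have hdC : commutator (absoluteGaloisGroup ℚ) ≤ d.ker := Abelianization.commutator_subset_ker d
  have hker : N ⊔ commutator (absoluteGaloisGroup ℚ) ≤ d.ker := sup_le hdN hdC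
  have hsq1 : ∀ g : absoluteGaloisGroup ℚ, d g * d g = 1 := fun g ↦ by
    rw [← map_mul]
    exact (MonoidHom.mem_ker).mp (hker (hsq g))
  -- but `d` takes the value `2`, and `2² = 4 ≠ 1` in `𝔽_p` for `p ≥ 5`
  have hcop : Nat.Coprime 2 p := (Nat.coprime_primes Nat.prime_two hp).mpr (by omega)
  obtain ⟨σ, hσ⟩ := hdetsurj (ZMod.unitOfCoprime 2 hcop)
  have h1 : (ZMod.unitOfCoprime 2 hcop : (ZMod p)ˣ) * ZMod.unitOfCoprime 2 hcop = 1 := by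
    have := hsq1 σ
    rwa [hd_apply, hσ] at this
  have h2 : ((2 : ℕ) : ZMod p) * ((2 : ℕ) : ZMod p) = 1 := by
    have := congrArg (fun u : (ZMod p)ˣ ↦ (u : ZMod p)) h1
    simpa only [Units.val_mul, Units.val_one, ZMod.coe_unitOfCoprime] using this
  have h3 : ((3 : ℕ) : ZMod p) = 0 := by
    push_cast at h2 ⊢
    linear_combination h2
  have hp3 : p ∣ 3 := (ZMod.natCast_eq_zero_iff 3 p).mp h3
  have : p ≤ 3 := Nat.le_of_dvd (by norm_num) hp3
  omega

/-- **`E(L)[p] = 0` for a number field of GENERALISED-DIHEDRAL type** (for `L` in `Type`): `W/ℚ`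
elliptic, `p ≥ 5` with `E[p]` irreducible, `N ⊴ Γ_ℚ` contained in the image of `Γ_L → Γ_ℚ`, and
`A ≤ Γ_ℚ`, `τ ∈ Γ_ℚ` with `τ² ∈ N`, `Γ_ℚ = A ∪ τA`, `τ a τ⁻¹ a ∈ N` for all `a ∈ A` (printed:
`L = H_n`, `N = Γ_{H_n}`, `A = Γ_K`, `τ` = complex conjugation inverting `Gal(H_n/K)`). MN19
Prop. 6.5: (C2) `E(H_n)[p] = 0` from the irreducibility (C5). [cite: MatarNekovar2019, Prop. 6.4 (C2), Prop. 6.5 (pp. 497–498)]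
[cite: GrossLMS1991, Lemma 4.3 (p. 242)] -/
theorem torsionBy_eq_bot_of_dihedral_of_hasIrreducibleModPGaloisRep_type {p : ℕ} (hp : p.Prime)
    (hp5 : 5 ≤ p) (hirr : W.HasIrreducibleModPGaloisRep p)
    (N : Subgroup (absoluteGaloisGroup ℚ)) [N.Normal] (A : Subgroup (absoluteGaloisGroup ℚ))
    (τ : absoluteGaloisGroup ℚ)
    (hN : ∀ n ∈ N, ∃ σ : absoluteGaloisGroup L, resGal (K := ℚ) L σ = n)
    (hτ : τ * τ ∈ N) (hcov : ∀ g : absoluteGaloisGroup ℚ, g ∈ A ∨ τ⁻¹ * g ∈ A)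
    (hinv : ∀ a ∈ A, τ * a * τ⁻¹ * a ∈ N) :
    AddSubgroup.torsionBy (W.baseChange L).toAffine.Point (p : ℤ) = ⊥ :=
  torsionBy_eq_bot_of_sq_mem_of_hasIrreducibleModPGaloisRep_type L W hp hp5 hirr N hN
    (mul_self_mem_sup_commutator_of_dihedral N A τ hτ hcov hinv)

end Torsion

/-! ## Universe-polymorphic statements and `p^M`-torsion -/

section Universe

/-- **Core statement, `L : Type u`** (transport along a `ℚ`-isomorphism `L₀ ≃ L` from a model in
`Type`, as in the surjective sibling). [cite: MatarNekovar2019, Prop. 6.5 ((C5) ⇒ (C2), p. 498)]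
[cite: GrossLMS1991, Lemma 4.3 (p. 242)] -/
theorem torsionBy_eq_bot_of_sq_mem_of_hasIrreducibleModPGaloisRep (W : WeierstrassCurve ℚ)
    [W.IsElliptic] {L : Type u} [Field L] [NumberField L] {L₀ : Type} [Field L₀] [NumberField L₀]
    (e : L₀ ≃ₐ[ℚ] L) {p : ℕ} (hp : p.Prime) (hp5 : 5 ≤ p) (hirr : W.HasIrreducibleModPGaloisRep p)
    (N : Subgroup (absoluteGaloisGroup ℚ)) [N.Normal]
    (hN : ∀ n ∈ N, ∃ τ : absoluteGaloisGroup L₀, resGal (K := ℚ) L₀ τ = n)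
    (hsq : ∀ g : absoluteGaloisGroup ℚ, g * g ∈ N ⊔ commutator (absoluteGaloisGroup ℚ)) :
    AddSubgroup.torsionBy (W.baseChange L).toAffine.Point (p : ℤ) = ⊥ :=
  torsionBy_eq_bot_of_algEquiv W e
    (torsionBy_eq_bot_of_sq_mem_of_hasIrreducibleModPGaloisRep_type L₀ W hp hp5 hirr N hN hsq)

/-- **Generalised-dihedral statement, `L : Type u`.** [cite: MatarNekovar2019, Prop. 6.4 (C2), Prop. 6.5 (pp. 497–498)]
[cite: GrossLMS1991, Lemma 4.3 (p. 242)] -/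
theorem torsionBy_eq_bot_of_dihedral_of_hasIrreducibleModPGaloisRep (W : WeierstrassCurve ℚ)
    [W.IsElliptic] {L : Type u} [Field L] [NumberField L] {L₀ : Type} [Field L₀] [NumberField L₀]
    (e : L₀ ≃ₐ[ℚ] L) {p : ℕ} (hp : p.Prime) (hp5 : 5 ≤ p) (hirr : W.HasIrreducibleModPGaloisRep p)
    (N : Subgroup (absoluteGaloisGroup ℚ)) [N.Normal] (A : Subgroup (absoluteGaloisGroup ℚ))
    (τ : absoluteGaloisGroup ℚ)
    (hN : ∀ n ∈ N, ∃ σ : absoluteGaloisGroup L₀, resGal (K := ℚ) L₀ σ = n)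
    (hτ : τ * τ ∈ N) (hcov : ∀ g : absoluteGaloisGroup ℚ, g ∈ A ∨ τ⁻¹ * g ∈ A)
    (hinv : ∀ a ∈ A, τ * a * τ⁻¹ * a ∈ N) :
    AddSubgroup.torsionBy (W.baseChange L).toAffine.Point (p : ℤ) = ⊥ :=
  torsionBy_eq_bot_of_algEquiv W e
    (torsionBy_eq_bot_of_dihedral_of_hasIrreducibleModPGaloisRep_type L₀ W hp hp5 hirr N A τ hN
      hτ hcov hinv)

/-- **`E(L)[p^M] = 0`** under the hypotheses of the core statement (McCallum 1991, §4 (5): no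
`K_n`-rational `p`-torsion makes `p^M`-division points unique). [cite: McCallumLMS1991, §4 (5)]
[cite: MatarNekovar2019, Prop. 6.5 ((C5) ⇒ (C2), p. 498)] -/
theorem torsionBy_pow_eq_bot_of_sq_mem_of_hasIrreducibleModPGaloisRep (W : WeierstrassCurve ℚ)
    [W.IsElliptic] {L : Type u} [Field L] [NumberField L] {L₀ : Type} [Field L₀] [NumberField L₀]
    (e : L₀ ≃ₐ[ℚ] L) {p : ℕ} (hp : p.Prime) (hp5 : 5 ≤ p) (hirr : W.HasIrreducibleModPGaloisRep p)
    (N : Subgroup (absoluteGaloisGroup ℚ)) [N.Normal]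
    (hN : ∀ n ∈ N, ∃ τ : absoluteGaloisGroup L₀, resGal (K := ℚ) L₀ τ = n)
    (hsq : ∀ g : absoluteGaloisGroup ℚ, g * g ∈ N ⊔ commutator (absoluteGaloisGroup ℚ)) (M : ℕ) :
    AddSubgroup.torsionBy (W.baseChange L).toAffine.Point ((p ^ M : ℕ) : ℤ) = ⊥ :=
  torsionBy_pow_eq_bot
    (torsionBy_eq_bot_of_sq_mem_of_hasIrreducibleModPGaloisRep W e hp hp5 hirr N hN hsq) M

/-- **`E(L)[p^M] = 0`** for `L` of generalised-dihedral type, `E[p]` irreducible, `p ≥ 5`.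
[cite: McCallumLMS1991, §4 (5)] [cite: MatarNekovar2019, Prop. 6.4 (C2), Prop. 6.5 (pp. 497–498)] -/
theorem torsionBy_pow_eq_bot_of_dihedral_of_hasIrreducibleModPGaloisRep (W : WeierstrassCurve ℚ)
    [W.IsElliptic] {L : Type u} [Field L] [NumberField L] {L₀ : Type} [Field L₀] [NumberField L₀]
    (e : L₀ ≃ₐ[ℚ] L) {p : ℕ} (hp : p.Prime) (hp5 : 5 ≤ p) (hirr : W.HasIrreducibleModPGaloisRep p)
    (N : Subgroup (absoluteGaloisGroup ℚ)) [N.Normal] (A : Subgroup (absoluteGaloisGroup ℚ))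
    (τ : absoluteGaloisGroup ℚ)
    (hN : ∀ n ∈ N, ∃ σ : absoluteGaloisGroup L₀, resGal (K := ℚ) L₀ σ = n)
    (hτ : τ * τ ∈ N) (hcov : ∀ g : absoluteGaloisGroup ℚ, g ∈ A ∨ τ⁻¹ * g ∈ A)
    (hinv : ∀ a ∈ A, τ * a * τ⁻¹ * a ∈ N) (M : ℕ) :
    AddSubgroup.torsionBy (W.baseChange L).toAffine.Point ((p ^ M : ℕ) : ℤ) = ⊥ :=
  torsionBy_pow_eq_bot
    (torsionBy_eq_bot_of_dihedral_of_hasIrreducibleModPGaloisRep W e hp hp5 hirr N A τ hN hτ hcov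
      hinv) M

end Universe

end Literature.NumberTheory.EllipticCurves

end
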